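import Literature.NumberTheory.Rogawski1990.SmoothTransferSplitPlaceHSide           -- ★ F0P3b-p01 `classOrbitalIntegral_comp_mulEquiv_eq_orbitalIntegral_of_isCanonical` (canonical class orbital integrals through `j : H ≃* M`); brings ★ `IsCanonical.atPoint_eq_quotientMeasure`
import Literature.NumberTheory.Automorphic.OrbitalMeasureCanonicalAtPoint          -- ★ `IsCanonical.classOrbitalIntegral_mk_eq_orbitalIntegral` (canonical family read at any representative)
import Literature.NumberTheory.Rogawski1990.GRegularLocalisation                   -- ★ `isLocalGRegular_out_mk`; brings ★ `isGRegular_of_isStablyConjH`, ★ `LocalTransfer` (`IsLocalGRegular`, `IsLocalStablyConjH`)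
import Summits.HodgeConjecture.HodgeConjecture.Theorems.R90S4SimilHaarInvariant     -- ★ p862007 (this seat) (H3) `map_prodCongr_cmDatumLocalCongr_eq_self` + `isStableFinsetH_of_isRogPacketH_of_simil`; brings the head ★ p861950
import Summits.HodgeConjecture.HodgeConjecture.Theorems.R90S4StableClassSimilPair    -- ★ p862051 (this seat) (H2) `exists_simil_forall_isLocalStablyConjH_out_iff`
import HarnessLib

/-!
# R90-TF · S4 (Rogawski Ch. 13.1–2) — letter (H4) of the S4#B6 road «restriction ∕ similitude» PAID: CANONICAL `G`-regular orbital integrals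
# of `H_v = U(Φ₂)_v × U(Φ₁)_v` are equivariant under similitude conjugation `E_T = Ad(T) × id`

Cell `hodgecm-mathlib`, crux H413 (`stmt-HodgeConjecture-24833`, lane `--supports … --as helper`), route of record `HCCMUnconditional`
(count-neutral).  Programme R90-TF, section S4 (dealer K2E2-plan (g6)); seat K2E3-p11 (g8); pays letter (H4) `hOrb` of ★ p861950
`Theorems/R90S4HPacketStable.lean`: for a CANONICAL orbital measure family `mH` (★ `OrbitalMeasureFamily.IsCanonical (IsLocalGRegular L v) νH mH`
— the socket's `hm`), a bi-invariant Haar measure `νH`, a similitude `T` of `Φ₂` and a `G`-regular `γ ∈ H_v`: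
`classOrbitalIntegral mH (f ∘ E_T) ⟦γ⟧ = classOrbitalIntegral mH f ⟦E_T γ⟧` for EVERY `f : H_v → ℂ`.

PROOF (Rogawski §4.3 p. 43 «the orbital integrals are defined using compatible measures»; Deitmar–Echterhoff Thm. 1.5.3).  Both sides are the
orbital integral at the POINT `E_T γ` against `νH ∕ ρ` for ONE canonically normalised Haar measure `ρ` on the centraliser `H_{E_T γ}`: the
left side by ★ `classOrbitalIntegral_comp_mulEquiv_eq_orbitalIntegral_of_isCanonical` (transport through `j := E_T`, with `(E_T)_* νH = νH` by
(H3) ★ `map_prodCongr_cmDatumLocalCongr_eq_self`), the right side by ★ `IsCanonical.classOrbitalIntegral_mk_eq_orbitalIntegral` (a canonical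
family read at any representative); `G`-regularity passes to `E_T γ` (a STABLE conjugate of `γ`, ★ `isGRegular_of_isStablyConjH`) and to the
chosen representatives (★ `isLocalGRegular_out_mk`); `ρ` exists by ★ `IsCanonical.atPoint_eq_quotientMeasure`.

HONEST LABEL: a ★-closable letter paid; the socket `stub_R90_S4_H_stable` stays OPEN modulo the two Harish-Chandra inputs (H1) (H5); HC_CM is
proved only modulo the 7 printed citations (2 remaining named inputs: hLiu418 = stmt-HodgeConjecture-24832, h413 = stmt-HodgeConjecture-24833)
until rung 0 closes; REL ≠ ★ ≠ BUILT; count-neutral.  §2 is the FINAL ASSEMBLY `isStableFinsetH_of_isRogPacketH_of_harishChandra`: the socket body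
from `hm` + (H1) + (H5) alone ((H2) ★ p862051, (H3) ★ p862007, (H4) §1).

## References
* [Rogawski1990] J. D. Rogawski, *Automorphic Representations of Unitary Groups in Three Variables*, Ann. of Math. Stud. 123 (1990), §4.3 (4.3.1)
  p. 43, §4.9 p. 54, §11.1 p. 161, §14.2 (14.2.1) p. 232.
* [DeitmarEchterhoff2014] A. Deitmar, S. Echterhoff, *Principles of Harmonic Analysis*, 2nd ed. (2014), Thm. 1.5.3.
* [LabesseLanglands1979] J.-P. Labesse, R. P. Langlands, *L-indistinguishability for SL(2)*, Canad. J. Math. 31 (1979), §2.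
-/

set_option autoImplicit false
set_option linter.dupNamespace false

noncomputable section

open MeasureTheory NumberField IsDedekindDomain
open scoped Matrix MatrixGroups
open Literature.NumberTheory.Automorphic Literature.NumberTheory.Automorphic.UnitaryGroup
open Literature.NumberTheory.Rogawski1990

namespace Summit.HodgeConjecture.HodgeConjecture.R90.S4

section CM

variable (L : Type) [Field L] [NumberField L] [IsCMField L] (v : HeightOneSpectrum (𝓞 ↥(maximalRealSubfield L)))

/-! ## §1 (H4): canonical `G`-regular orbital integrals through `E_T` -/

/-- `E_T γ` is stably conjugate to `γ` (`T ∈ GL₂(L ⊗ L⁺_v)` conjugates the `U(Φ₂)`-components; the `U(Φ₁)`-components agree).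
[cite: Rogawski1990, §3.1 p. 19; §11.1 p. 161] -/
theorem isLocalStablyConjH_prodCongr_cmDatumLocalCongr (T : GL (Fin 2) (LocalRing L v)) {a : LocalRing L v} (ha : IsUnit a)
    (hT : formCongr (conjLocal L (IsCMField.complexConj L) v) T
        ((Matrix.of fun i j : Fin 2 => if i.val + j.val + 1 = 2 then (1 : L) else 0).map (algebraMap L (LocalRing L v))) =
      a • (Matrix.of fun i j : Fin 2 => if i.val + j.val + 1 = 2 then (1 : L) else 0).map (algebraMap L (LocalRing L v)))
    (γ : (cmDatum L 2 (Matrix.of fun i j : Fin 2 => if i.val + j.val + 1 = 2 then (1 : L) else 0)).Local v ×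
      (cmDatum L 1 (Matrix.of fun i j : Fin 1 => if i.val + j.val + 1 = 1 then (1 : L) else 0)).Local v) :
    IsLocalStablyConjH L v γ
      (Literature.Topology.ContinuousMulEquiv.prodCongr (cmDatumLocalCongr L v T ha hT)
        (ContinuousMulEquiv.refl ((cmDatum L 1 (Matrix.of fun i j : Fin 1 => if i.val + j.val + 1 = 1 then (1 : L) else 0)).Local v)) γ) := by
  show IsStablyConj _ _ _ _ ∧ IsStablyConj _ _ _ _
  exact ⟨isStablyConj_iff.2 ⟨_, (coe_cmDatumLocalCongr_apply L v T ha hT γ.1).symm⟩, IsStablyConj.refl _⟩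

/-- **LETTER (H4) PAID — canonical `G`-regular orbital integrals are `E_T`-equivariant.**  For `mH` canonical for (`G`-regular, `νH`), `νH` a
left- and right-invariant Haar measure on `H_v`, a similitude `T` of `Φ₂` with unit multiplier, a `G`-regular `γ ∈ H_v` and ANY `f : H_v → ℂ`:
`classOrbitalIntegral mH (f ∘ E_T) ⟦γ⟧ = classOrbitalIntegral mH f ⟦E_T γ⟧` — both are `∫_{H_v ∕ H_{E_T γ}} f(x · E_T γ · x⁻¹) d(νH ∕ ρ)` for a
canonically normalised `ρ`.  This is the hypothesis `hOrb` of ★ `isStableFinsetH_of_isRogPacketH` (which quantifies it over test functions only).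
[cite: Rogawski1990, §4.3 (4.3.1) p. 43; §4.9 p. 54; §11.1 p. 161] [cite: DeitmarEchterhoff2014, Thm. 1.5.3] -/
theorem classOrbitalIntegral_comp_prodCongr_cmDatumLocalCongr_eq
    [MeasurableSpace ((cmDatum L 2 (Matrix.of fun i j : Fin 2 => if i.val + j.val + 1 = 2 then (1 : L) else 0)).Local v ×
      (cmDatum L 1 (Matrix.of fun i j : Fin 1 => if i.val + j.val + 1 = 1 then (1 : L) else 0)).Local v)]
    [BorelSpace ((cmDatum L 2 (Matrix.of fun i j : Fin 2 => if i.val + j.val + 1 = 2 then (1 : L) else 0)).Local v ×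
      (cmDatum L 1 (Matrix.of fun i j : Fin 1 => if i.val + j.val + 1 = 1 then (1 : L) else 0)).Local v)]
    [∀ a : ((cmDatum L 2 (Matrix.of fun i j : Fin 2 => if i.val + j.val + 1 = 2 then (1 : L) else 0)).Local v ×
        (cmDatum L 1 (Matrix.of fun i j : Fin 1 => if i.val + j.val + 1 = 1 then (1 : L) else 0)).Local v),
      MeasurableSpace (((cmDatum L 2 (Matrix.of fun i j : Fin 2 => if i.val + j.val + 1 = 2 then (1 : L) else 0)).Local v ×
        (cmDatum L 1 (Matrix.of fun i j : Fin 1 => if i.val + j.val + 1 = 1 then (1 : L) else 0)).Local v) ⧸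
        Subgroup.centralizer ({a} : Set ((cmDatum L 2 (Matrix.of fun i j : Fin 2 => if i.val + j.val + 1 = 2 then (1 : L) else 0)).Local v ×
        (cmDatum L 1 (Matrix.of fun i j : Fin 1 => if i.val + j.val + 1 = 1 then (1 : L) else 0)).Local v)))]
    [∀ a : ((cmDatum L 2 (Matrix.of fun i j : Fin 2 => if i.val + j.val + 1 = 2 then (1 : L) else 0)).Local v ×
        (cmDatum L 1 (Matrix.of fun i j : Fin 1 => if i.val + j.val + 1 = 1 then (1 : L) else 0)).Local v),
      BorelSpace (((cmDatum L 2 (Matrix.of fun i j : Fin 2 => if i.val + j.val + 1 = 2 then (1 : L) else 0)).Local v ×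
        (cmDatum L 1 (Matrix.of fun i j : Fin 1 => if i.val + j.val + 1 = 1 then (1 : L) else 0)).Local v) ⧸
        Subgroup.centralizer ({a} : Set ((cmDatum L 2 (Matrix.of fun i j : Fin 2 => if i.val + j.val + 1 = 2 then (1 : L) else 0)).Local v ×
        (cmDatum L 1 (Matrix.of fun i j : Fin 1 => if i.val + j.val + 1 = 1 then (1 : L) else 0)).Local v)))]
    (νH : Measure ((cmDatum L 2 (Matrix.of fun i j : Fin 2 => if i.val + j.val + 1 = 2 then (1 : L) else 0)).Local v ×
      (cmDatum L 1 (Matrix.of fun i j : Fin 1 => if i.val + j.val + 1 = 1 then (1 : L) else 0)).Local v))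
    [νH.IsHaarMeasure] [νH.IsMulRightInvariant]
    (mH : OrbitalMeasureFamily ((cmDatum L 2 (Matrix.of fun i j : Fin 2 => if i.val + j.val + 1 = 2 then (1 : L) else 0)).Local v ×
      (cmDatum L 1 (Matrix.of fun i j : Fin 1 => if i.val + j.val + 1 = 1 then (1 : L) else 0)).Local v))
    (hm : mH.IsCanonical (IsLocalGRegular L v) νH)
    (T : GL (Fin 2) (LocalRing L v)) (a : LocalRing L v) (ha : IsUnit a)
    (hT : formCongr (conjLocal L (IsCMField.complexConj L) v) T
        ((Matrix.of fun i j : Fin 2 => if i.val + j.val + 1 = 2 then (1 : L) else 0).map (algebraMap L (LocalRing L v))) =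
      a • (Matrix.of fun i j : Fin 2 => if i.val + j.val + 1 = 2 then (1 : L) else 0).map (algebraMap L (LocalRing L v)))
    (γ : (cmDatum L 2 (Matrix.of fun i j : Fin 2 => if i.val + j.val + 1 = 2 then (1 : L) else 0)).Local v ×
      (cmDatum L 1 (Matrix.of fun i j : Fin 1 => if i.val + j.val + 1 = 1 then (1 : L) else 0)).Local v)
    (hγ : IsLocalGRegular L v γ)
    (f : (cmDatum L 2 (Matrix.of fun i j : Fin 2 => if i.val + j.val + 1 = 2 then (1 : L) else 0)).Local v ×
      (cmDatum L 1 (Matrix.of fun i j : Fin 1 => if i.val + j.val + 1 = 1 then (1 : L) else 0)).Local v → ℂ) :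
    classOrbitalIntegral mH (f ∘ (Literature.Topology.ContinuousMulEquiv.prodCongr (cmDatumLocalCongr L v T ha hT)
        (ContinuousMulEquiv.refl ((cmDatum L 1 (Matrix.of fun i j : Fin 1 => if i.val + j.val + 1 = 1 then (1 : L) else 0)).Local v))))
        (ConjClasses.mk γ) =
      classOrbitalIntegral mH f (ConjClasses.mk (Literature.Topology.ContinuousMulEquiv.prodCongr (cmDatumLocalCongr L v T ha hT)
        (ContinuousMulEquiv.refl ((cmDatum L 1 (Matrix.of fun i j : Fin 1 => if i.val + j.val + 1 = 1 then (1 : L) else 0)).Local v)) γ)) := by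
  set E := Literature.Topology.ContinuousMulEquiv.prodCongr (cmDatumLocalCongr L v T ha hT)
    (ContinuousMulEquiv.refl ((cmDatum L 1 (Matrix.of fun i j : Fin 1 => if i.val + j.val + 1 = 1 then (1 : L) else 0)).Local v))
    with hE
  -- `G`-regularity of `E γ` and of the chosen representatives
  have hst : IsLocalStablyConjH L v γ (E γ) := isLocalStablyConjH_prodCongr_cmDatumLocalCongr L v T ha hT γ
  have hγ' : IsLocalGRegular L v (E γ) := isGRegular_of_isStablyConjH _ _ _ _ hst hγ
  have hP : IsLocalGRegular L v (Quotient.out (ConjClasses.mk γ)) := isLocalGRegular_out_mk hγ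
  have hP' : IsLocalGRegular L v (Quotient.out (ConjClasses.mk (E γ))) := isLocalGRegular_out_mk hγ'
  -- (H3): `E_* νH = νH`
  have hνM : νH = Measure.map (E.toMulEquiv) νH := by
    rw [show ((E.toMulEquiv : _ ≃* _) : _ → _) = (E : _ → _) from rfl, hE, map_prodCongr_cmDatumLocalCongr_eq_self L v νH T a ha hT]
  -- a canonically normalised Haar measure `ρ` on the centraliser of `E γ`
  obtain ⟨ρ, hρH, hρi, hρ1, -⟩ := hm.atPoint_eq_quotientMeasure (E γ) hP'
  -- left side: transport through `j := E`; right side: the canonical family read at the representative `E γ`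
  have hL := classOrbitalIntegral_comp_mulEquiv_eq_orbitalIntegral_of_isCanonical E.toMulEquiv E.continuous E.symm.continuous hm γ hP
    νH hνM ρ hρ1 f
  have hR := hm.classOrbitalIntegral_mk_eq_orbitalIntegral hP' ρ hρ1 f
  exact hL.trans hR.symm

/-! ## §2 FINAL ASSEMBLY — the socket `stub_R90_S4_H_stable` from the two Harish-Chandra inputs (H1) (H5) only -/

/-- **S4#B6 `_stable` ⟸ (H1) + (H5): the packet trace of every Rogawski `H_v`-packet is a STABLE distribution, GIVEN ONLY Harish-Chandra's
«`G`-regular orbital integrals determine admissible characters» (H1 = local integrability of characters + Weyl integration + null singular set)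
and «`G`-regular orbital integrands of test functions are integrable» (H5)** — the letters (H2) ★ p862051, (H3) ★ p862007, (H4) §1 of the road
of record being now theorems.  Binders = the socket's (`νH` Haar and right-invariant, `mH` canonical for `G`-regular classes — `hm` is USED), then
`hInt`, `hHC`, then `S`, `hS : ‹IsRogPacketH L v S›` and the conclusion `‹R90.S3.IsStableFinsetH L v νH mH S›`, both UNFOLDED token for token.
[cite: Rogawski1990, §11.1 p. 161; §3.1 p. 19; §3.6 pp. 31–32; §4.1 pp. 39–40; §4.3 p. 43; §13.1 Thm. 13.1.1 (2) p. 198] [cite: LabesseLanglands1979, §2]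
[cite: HarishChandra1999, Thm. 16.3] -/
theorem isStableFinsetH_of_isRogPacketH_of_harishChandra
    [MeasurableSpace ((cmDatum L 2 (Matrix.of fun i j : Fin 2 => if i.val + j.val + 1 = 2 then (1 : L) else 0)).Local v ×
      (cmDatum L 1 (Matrix.of fun i j : Fin 1 => if i.val + j.val + 1 = 1 then (1 : L) else 0)).Local v)]
    [BorelSpace ((cmDatum L 2 (Matrix.of fun i j : Fin 2 => if i.val + j.val + 1 = 2 then (1 : L) else 0)).Local v ×
      (cmDatum L 1 (Matrix.of fun i j : Fin 1 => if i.val + j.val + 1 = 1 then (1 : L) else 0)).Local v)]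
    [∀ a : ((cmDatum L 2 (Matrix.of fun i j : Fin 2 => if i.val + j.val + 1 = 2 then (1 : L) else 0)).Local v ×
        (cmDatum L 1 (Matrix.of fun i j : Fin 1 => if i.val + j.val + 1 = 1 then (1 : L) else 0)).Local v),
      MeasurableSpace (((cmDatum L 2 (Matrix.of fun i j : Fin 2 => if i.val + j.val + 1 = 2 then (1 : L) else 0)).Local v ×
        (cmDatum L 1 (Matrix.of fun i j : Fin 1 => if i.val + j.val + 1 = 1 then (1 : L) else 0)).Local v) ⧸
        Subgroup.centralizer ({a} : Set ((cmDatum L 2 (Matrix.of fun i j : Fin 2 => if i.val + j.val + 1 = 2 then (1 : L) else 0)).Local v ×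
        (cmDatum L 1 (Matrix.of fun i j : Fin 1 => if i.val + j.val + 1 = 1 then (1 : L) else 0)).Local v)))]
    [∀ a : ((cmDatum L 2 (Matrix.of fun i j : Fin 2 => if i.val + j.val + 1 = 2 then (1 : L) else 0)).Local v ×
        (cmDatum L 1 (Matrix.of fun i j : Fin 1 => if i.val + j.val + 1 = 1 then (1 : L) else 0)).Local v),
      BorelSpace (((cmDatum L 2 (Matrix.of fun i j : Fin 2 => if i.val + j.val + 1 = 2 then (1 : L) else 0)).Local v ×
        (cmDatum L 1 (Matrix.of fun i j : Fin 1 => if i.val + j.val + 1 = 1 then (1 : L) else 0)).Local v) ⧸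
        Subgroup.centralizer ({a} : Set ((cmDatum L 2 (Matrix.of fun i j : Fin 2 => if i.val + j.val + 1 = 2 then (1 : L) else 0)).Local v ×
        (cmDatum L 1 (Matrix.of fun i j : Fin 1 => if i.val + j.val + 1 = 1 then (1 : L) else 0)).Local v)))]
    (νH : Measure ((cmDatum L 2 (Matrix.of fun i j : Fin 2 => if i.val + j.val + 1 = 2 then (1 : L) else 0)).Local v ×
      (cmDatum L 1 (Matrix.of fun i j : Fin 1 => if i.val + j.val + 1 = 1 then (1 : L) else 0)).Local v))
    [νH.IsHaarMeasure] [νH.IsMulRightInvariant]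
    (mH : OrbitalMeasureFamily ((cmDatum L 2 (Matrix.of fun i j : Fin 2 => if i.val + j.val + 1 = 2 then (1 : L) else 0)).Local v ×
      (cmDatum L 1 (Matrix.of fun i j : Fin 1 => if i.val + j.val + 1 = 1 then (1 : L) else 0)).Local v))
    (hm : mH.IsCanonical (IsLocalGRegular L v) νH)
    (hInt : ∀ γ : (cmDatum L 2 (Matrix.of fun i j : Fin 2 => if i.val + j.val + 1 = 2 then (1 : L) else 0)).Local v ×
        (cmDatum L 1 (Matrix.of fun i j : Fin 1 => if i.val + j.val + 1 = 1 then (1 : L) else 0)).Local v,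
      IsLocalGRegular L v γ →
        ∀ f : (cmDatum L 2 (Matrix.of fun i j : Fin 2 => if i.val + j.val + 1 = 2 then (1 : L) else 0)).Local v ×
          (cmDatum L 1 (Matrix.of fun i j : Fin 1 => if i.val + j.val + 1 = 1 then (1 : L) else 0)).Local v → ℂ,
        IsLocSmooth f →
        Integrable (Literature.MeasureTheory.Group.descConj (Quotient.out (ConjClasses.mk γ))
          (Subgroup.centralizer ({(Quotient.out (ConjClasses.mk γ) : (cmDatum L 2 (Matrix.of fun i j : Fin 2 => if i.val + j.val + 1 = 2 then (1 : L) else 0)).Local v ×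
            (cmDatum L 1 (Matrix.of fun i j : Fin 1 => if i.val + j.val + 1 = 1 then (1 : L) else 0)).Local v)} : Set _))
          (fun _ hg => Subgroup.mem_centralizer_singleton_iff.1 hg) f) (mH (ConjClasses.mk γ)))
    (hHC : ∀ σ : IrrClass ((cmDatum L 2 (Matrix.of fun i j : Fin 2 => if i.val + j.val + 1 = 2 then (1 : L) else 0)).Local v ×
        (cmDatum L 1 (Matrix.of fun i j : Fin 1 => if i.val + j.val + 1 = 1 then (1 : L) else 0)).Local v), σ.IsAdmissible →
      ∀ f f' : (cmDatum L 2 (Matrix.of fun i j : Fin 2 => if i.val + j.val + 1 = 2 then (1 : L) else 0)).Local v ×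
        (cmDatum L 1 (Matrix.of fun i j : Fin 1 => if i.val + j.val + 1 = 1 then (1 : L) else 0)).Local v → ℂ,
        IsLocSmooth f → IsLocSmooth f' →
        (∀ γ, IsLocalGRegular L v γ → classOrbitalIntegral mH f (ConjClasses.mk γ) = classOrbitalIntegral mH f' (ConjClasses.mk γ)) →
        σ.smoothTrace νH f = σ.smoothTrace νH f')
    (S : Finset (IrrClass
      ((cmDatum L 2 (Matrix.of fun i j : Fin 2 => if i.val + j.val + 1 = 2 then (1 : L) else 0)).Local v ×
        (cmDatum L 1 (Matrix.of fun i j : Fin 1 => if i.val + j.val + 1 = 1 then (1 : L) else 0)).Local v)))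
    (hS : ∃ (O : Finset (IrrClass ((cmDatum L 2 (Matrix.of fun i j : Fin 2 => if i.val + j.val + 1 = 2 then (1 : L) else 0)).Local v)))
        (χ : (cmDatum L 1 (Matrix.of fun i j : Fin 1 => if i.val + j.val + 1 = 1 then (1 : L) else 0)).Local v →* ℂˣ)
        (hχ : IsOpen ((χ.ker : Subgroup
            ((cmDatum L 1 (Matrix.of fun i j : Fin 1 => if i.val + j.val + 1 = 1 then (1 : L) else 0)).Local v)) :
          Set ((cmDatum L 1 (Matrix.of fun i j : Fin 1 => if i.val + j.val + 1 = 1 then (1 : L) else 0)).Local v))),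
        (∃ σ : IrrClass ((cmDatum L 2 (Matrix.of fun i j : Fin 2 => if i.val + j.val + 1 = 2 then (1 : L) else 0)).Local v),
          σ.IsAdmissible ∧ ∀ c, c ∈ O ↔
            ∃ (T : GL (Fin 2) (LocalRing L v)) (a : LocalRing L v) (ha : IsUnit a)
              (h : formCongr (conjLocal L (IsCMField.complexConj L) v) T
                ((Matrix.of fun i j : Fin 2 => if i.val + j.val + 1 = 2 then (1 : L) else 0).map (algebraMap L (LocalRing L v))) =
                a • (Matrix.of fun i j : Fin 2 => if i.val + j.val + 1 = 2 then (1 : L) else 0).map (algebraMap L (LocalRing L v))),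
              c = IrrClass.comap (cmDatumLocalCongr L v T ha h) σ) ∧
        S = O.map ⟨IrrClass.boxChar χ hχ, IrrClass.boxChar_injective χ hχ⟩) :
    ∀ fH fH' : ((cmDatum L 2 (Matrix.of fun i j : Fin 2 => if i.val + j.val + 1 = 2 then (1 : L) else 0)).Local v ×
        (cmDatum L 1 (Matrix.of fun i j : Fin 1 => if i.val + j.val + 1 = 1 then (1 : L) else 0)).Local v) → ℂ,
      IsLocSmooth fH → IsLocSmooth fH' →
        (∀ γH, IsLocalGRegular L v γH →
          stableOrbitalIntegralRel (IsLocalStablyConjH L v) mH fH γH = stableOrbitalIntegralRel (IsLocalStablyConjH L v) mH fH' γH) →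
        ∑ σ ∈ S, σ.smoothTrace νH fH = ∑ σ ∈ S, σ.smoothTrace νH fH' := by
  obtain ⟨T, a, ha, hT, hST⟩ := exists_simil_forall_isLocalStablyConjH_out_iff L v
  exact isStableFinsetH_of_isRogPacketH_of_simil L v νH mH T a ha hT hST
    (fun γ hγ f _ => classOrbitalIntegral_comp_prodCongr_cmDatumLocalCongr_eq L v νH mH hm T a ha hT γ hγ f) hInt hHC S hS

end CM

end Summit.HodgeConjecture.HodgeConjecture.R90.S4

end
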